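import Summits.ValiantsHypothesis.ValiantsHypothesis.Theorems.DefinabilityGapSkeletonFlag
import HarnessLib

/-!
# DefinabilityGap — free axes: `G_m` hits every NONSINGULAR read-once chain of width `w ≤ (m+1)/2`

Helper under **the leaf the read-once route asks for**, stmt-23704 `KIPlantedHittingRO`
(*leaf asks width `q^b`, degree `q^b`, arbitrary read-once order `π`*), rev-10 route
`Theses/DefinabilityGap.lean` (DRAFT); `P_c = kiPer m c`, `φ = bind₁ (kiPer m)`.  Second half
of the lineage-5 g34 node; the first half is `DefinabilityGapSkeletonFlag.lean` (the
generator-free `(w − 1)`-support witness theorem).  **0 S-currency · closes NO item · the leaf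
23704, the K1 / F4 / W10 tags, rev-10 `closes` and `VP ≠ VNP` are untouched.**

## What is proved

* §1 THE FREE-AXES SUBSTITUTION `Θ_{S,ι,i₀,t}` (`freeFun`/`freeHom`), generalising the
  one-block translated axis `…TranslatedSkeleton.transFun` to a finite set `S` of FREE blocks:
  `X_c − t` at the private diagonal cell `E_c(ι c, ι c)` of each `c ∈ S`, `1` on the other
  diagonal cells of the free blocks, `t` on the rotated-diagonal column `i₀`, `1` on the other
  rotated-diagonal columns, `0` elsewhere.  With `m ≥ 3`, `2·|S| < m` and PRIVATE cells
  (`E_c(ι c, ι c)` in no other free block — such `ι` exists, `exists_private`, because two blocks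
  share `≤ 2` cells [DefinabilityGapZeroedBlocks.card_cells_inter_le]):
  (T1) `Θ(P_c) = X_c` for `c ∈ S`; (T2) `Θ(P_b) = t` for `b ∉ S`; hence
  (T3) `Θ(φ E) = E|_{z_b := t, b ∉ S}` — every restriction of `E` to `|S| < m/2` free variables
  is an algebra-hom image of `φ E`, so `φ E = 0` forces all of them to vanish
  (`aeval_restrict_eq_zero`).
* §2 ★ `kiPer_hits_chainPoly`: for `3 ≤ m`, `2w ≤ m + 1`, an injective read order `π` and
  univariate links `P_i ∈ M_w(ℂ[X])` with `det P_i ≠ 0` (as polynomials), a nonzero chain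
  polynomial `uᵀ P_1(z_{π 1}) ⋯ P_N(z_{π N}) v` stays nonzero under `φ`: pick `t` off the
  finitely many roots of the `det P_i`, combine (T3) with
  `…SkeletonFlag.chainPoly_eq_zero_of_restrict`.  Corollary `kiPer_hits_matrixProduct_of_det_ne_zero`
  in the `(List.ofFn M).prod a b` currency of `Literature…FSV18SuccinctGenerators.IsROABP`.

## Honest label · placement on the width road

K4′ HONESTY (CALL 2490, verbatim): «ELEMENTARY · VARIANT: the (w−1)-support witness is CLASSICAL in
kind (weighted-automata / ROABP low-support lineage, cites); NEW only in G_m's currency = the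
multi-block free axes; det ≠ 0 sharp in kind; 2w ≤ m + 1 = the free-block budget, NOT claimed
optimal; singular links of width ≥ 3 and the leaf regime w = q^b ≫ m NOT claimed; leaf asks width
q^b; 0 S-currency; closes NO item; K1 / F4 / W10 tags untouched».
In detail: ELEMENTARY · VARIANT (multi-block version of the g33 translated axis + the classical
small-support witness for nonsingular read-once products; ROABP hitting is CLASSICAL
[SahaSaptharishiSaxena2009]-lineage, Agrawal–Saha–Saxena 2013, Forbes–Saptharishi–Shpilka 2014 —
new only in `G_m`'s currency).  Rung «NONSINGULAR LINKS, EVERY CONSTANT WIDTH `w`, `m ≥ max(3, 2w−1)`,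
ANY order, ANY number of blocks» strictly under leaf 23704: for `w = 2` it is the g33 theorem
`…TranslatedSkeleton.kiPer_hits_widthTwo_of_det_ne_zero` again (here `m ≥ 3` too); for `w = 3`
it needs `m ≥ 5`.  NOT claimed: singular (rank-dropping) links of width `≥ 3` — the width-2
singular case is `…SingularSplitting`, whose rank-one splitting is width-2-specific (`det ≠ 0` is
sharp in kind: `(z₁ − z₂)(z₃ − z₄)` is a nonzero width-2 chain with singular links all of whose
restrictions to `≤ 1` free variable vanish); the leaf asks width `q^b ≫ m`, where `2w ≤ m + 1`
fails outright — the bound `2w ≤ m + 1` is what the free-block budget `2·|S| < m` affords, not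
claimed optimal.  0 S-currency; closes NO item. [rung nonsingular constant width under leaf 23704 ·
0 S-currency · closes NO item]

## Worked instance (a member of the NEW class, not decided by the width-2 files)

`m ≥ 5`, any `N ≥ 4` distinct blocks `c_1, …, c_N` (crowded regime allowed), `w = 3`,
`U(z) = [[1,z,0],[0,1,z],[0,0,1]]` (`det = 1`), `u = e₀`, `v = e₂`: the chain polynomial is
`e₂(z_{c_1}, …, z_{c_N})` (width-3-essential: Nisan cut-rank `3`), and ★ gives
`e₂(P_{c_1}, …, P_{c_N}) ≠ 0`.
-/

noncomputable section

open MvPolynomial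

open scoped Polynomial

open Literature.Computability.AlgebraicComplexity Literature.Computability.MetaComplexity

open Summit.ValiantsHypothesis.ValiantsHypothesis.Theorems.DefinabilityGapAffineRung

open Summit.ValiantsHypothesis.ValiantsHypothesis.Theorems.DefinabilityGapZeroedBlocks

open Summit.ValiantsHypothesis.ValiantsHypothesis.Theorems.DefinabilityGapAxisSubstitution

open Summit.ValiantsHypothesis.ValiantsHypothesis.Theorems.DefinabilityGapPivotCertificate

open Summit.ValiantsHypothesis.ValiantsHypothesis.Theorems.DefinabilityGapTranslatedSkeleton

open Summit.ValiantsHypothesis.ValiantsHypothesis.Theorems.DefinabilityGapSkeletonFlag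

set_option linter.dupNamespace false

namespace Summit.ValiantsHypothesis.ValiantsHypothesis.Theorems.DefinabilityGapFreeAxes

variable {m : ℕ}

/-! ## 1. The free-axes substitution `Θ_{S,ι,i₀,t}` -/

/-- The free-axes substitution: `X_c − t` at the private diagonal cell `E_c(ι c, ι c)` of each
free block `c ∈ S`, `1` on the other diagonal cells of the free blocks, `t` on the rotated-diagonal
column `i₀`, `1` on the other rotated-diagonal columns, `0` elsewhere. [this file, data] -/
def freeFun (m : ℕ) (S : Finset (Fin 3 → Fin (qOf m))) (ι : (Fin 3 → Fin (qOf m)) → Fin m)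
    (i₀ : Fin m) (t : ℂ) (x : Fin (qOf m) × Fin (qOf m)) : MvPolynomial (Fin 3 → Fin (qOf m)) ℂ :=
  if x ∈ S.image fun c => cellEmb m c (ι c, ι c) then
    ∑ c ∈ S, if x = cellEmb m c (ι c, ι c) then X c - C t else 0
  else if x ∈ S.biUnion (diagCells m) then 1
  else if x.1 = rotCol m i₀ then C t
  else if x.1 ∈ Finset.univ.image (rotCol m) then 1 else 0

/-- `Θ_{S,ι,i₀,t}` as a `ℂ`-algebra map. [this file, data] -/
def freeHom (m : ℕ) (S : Finset (Fin 3 → Fin (qOf m))) (ι : (Fin 3 → Fin (qOf m)) → Fin m)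
    (i₀ : Fin m) (t : ℂ) :
    MvPolynomial (Fin (qOf m) × Fin (qOf m)) ℂ →ₐ[ℂ] MvPolynomial (Fin 3 → Fin (qOf m)) ℂ :=
  aeval (freeFun m S ι i₀ t)

/-- `Θ` at an OFF-diagonal position `(r, i)` of ANY block: `t` / `1` on the rotated diagonal
(column `i₀` / the others), `0` off it. -/
theorem freeFun_offDiag (S : Finset (Fin 3 → Fin (qOf m))) (ι : (Fin 3 → Fin (qOf m)) → Fin m)
    (i₀ : Fin m) (t : ℂ) (b : Fin 3 → Fin (qOf m)) {r i : Fin m} (hri : r ≠ i) :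
    freeFun m S ι i₀ t (cellEmb m b (r, i)) =
      if r = finRotate m i then (if i = i₀ then C t else 1) else 0 := by
  have h1 : cellEmb m b (r, i) ∉ S.image fun c => cellEmb m c (ι c, ι c) := fun h => by
    obtain ⟨c, -, hc⟩ := Finset.mem_image.1 h
    have h := Prod.ext_iff.1 (cellEmb_fst_eq_iff.1 (congrArg Prod.fst hc))
    exact hri (h.1.symm.trans h.2)
  have h2 : cellEmb m b (r, i) ∉ S.biUnion (diagCells m) := fun h => by
    obtain ⟨c, -, hc⟩ := Finset.mem_biUnion.1 h
    obtain ⟨j, hj⟩ := mem_diagCells.1 hc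
    have h := Prod.ext_iff.1 (cellEmb_fst_eq_iff.1 (congrArg Prod.fst hj))
    exact hri (h.1.symm.trans h.2)
  have hcol : ∀ j, (cellEmb m b (r, i)).1 = rotCol m j ↔ r = finRotate m i ∧ i = j := fun j => by
    rw [rotCol, cellEmb_fst, (permPad (sq_le_qOf m)).injective.eq_iff, Prod.mk.injEq]
    exact ⟨fun h => ⟨h.1.trans (by rw [h.2]), h.2⟩, fun h => ⟨h.1.trans (by rw [h.2]), h.2⟩⟩
  by_cases hr : r = finRotate m i
  · subst hr
    have hmem : (cellEmb m b (finRotate m i, i)).1 ∈ Finset.univ.image (rotCol m) :=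
      Finset.mem_image.2 ⟨i, Finset.mem_univ _, ((hcol i).2 ⟨rfl, rfl⟩).symm⟩
    rw [if_pos rfl, freeFun, if_neg h1, if_neg h2]
    by_cases hi : i = i₀
    · rw [if_pos ((hcol i₀).2 ⟨rfl, hi⟩), if_pos hi]
    · rw [if_neg fun h => hi ((hcol i₀).1 h).2, if_pos hmem, if_neg hi]
  · have hmem : (cellEmb m b (r, i)).1 ∉ Finset.univ.image (rotCol m) := fun hmem => by
      obtain ⟨j, -, hj⟩ := Finset.mem_image.1 hmem
      exact hr ((hcol j).1 hj.symm).1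
    rw [if_neg hr, freeFun, if_neg h1, if_neg h2, if_neg fun h => hr ((hcol i₀).1 h).1, if_neg hmem]

/-- Under `Θ` the permanent of ANY block `b` is (its diagonal term) `+ t` (`m ≥ 3`). -/
theorem freeHom_kiPer (hm : 3 ≤ m) (S : Finset (Fin 3 → Fin (qOf m)))
    (ι : (Fin 3 → Fin (qOf m)) → Fin m) (i₀ : Fin m) (t : ℂ) (b : Fin 3 → Fin (qOf m)) :
    freeHom m S ι i₀ t (kiPer m b) = (∏ i, freeFun m S ι i₀ t (cellEmb m b (i, i))) + C t := by
  classical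
  have hfix : ∀ i : Fin m, finRotate m i ≠ i := fun i =>
    Equiv.Perm.mem_support.1
      (by rw [support_finRotate_of_le (by omega : 2 ≤ m)]; exact Finset.mem_univ i)
  have hrot : (1 : Equiv.Perm (Fin m)) ≠ finRotate m := fun e => hfix i₀ (by simp [← e])
  rw [freeHom, aeval_kiPer, Finset.sum_eq_add_of_mem (1 : Equiv.Perm (Fin m)) (finRotate m)
    (Finset.mem_univ _) (Finset.mem_univ _) hrot]
  · simp only [Equiv.Perm.coe_one, id_eq]
    rw [Finset.prod_congr rfl fun i _ => (freeFun_offDiag S ι i₀ t b (hfix i)).trans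
      (if_pos rfl), Finset.prod_ite_eq', if_pos (Finset.mem_univ _)]
  · intro ρ _ hρ
    obtain ⟨i, h1, h2⟩ := exists_off_patterns (by omega) hρ.1 hρ.2
    exact Finset.prod_eq_zero (Finset.mem_univ i) (by rw [freeFun_offDiag S ι i₀ t b h1, if_neg h2])

/-- **(T1)** the diagonal of a free block `c ∈ S` with private cells gives `X_c − t`. -/
theorem prod_freeFun_of_mem (S : Finset (Fin 3 → Fin (qOf m)))
    (ι : (Fin 3 → Fin (qOf m)) → Fin m) (i₀ : Fin m) (t : ℂ)
    (hι : ∀ c ∈ S, ∀ c' ∈ S, c' ≠ c → cellEmb m c (ι c, ι c) ∉ cells m c')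
    {c : Fin 3 → Fin (qOf m)} (hc : c ∈ S) :
    ∏ i, freeFun m S ι i₀ t (cellEmb m c (i, i)) = X c - C t := by
  classical
  rw [← Finset.mul_prod_erase Finset.univ _ (Finset.mem_univ (ι c)), Finset.prod_eq_one, mul_one]
  · have hmem : cellEmb m c (ι c, ι c) ∈ S.image fun c' => cellEmb m c' (ι c', ι c') :=
      Finset.mem_image.2 ⟨c, hc, rfl⟩
    rw [freeFun, if_pos hmem, Finset.sum_eq_single_of_mem c hc, if_pos rfl]
    intro c' hc' hne
    refine if_neg fun e => hι c' hc' c hc hne.symm ?_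
    rw [← e]
    exact Finset.mem_map.2 ⟨(ι c, ι c), Finset.mem_univ _, rfl⟩
  · intro i hi
    have hi' : i ≠ ι c := Finset.ne_of_mem_erase hi
    have hnot : cellEmb m c (i, i) ∉ S.image fun c' => cellEmb m c' (ι c', ι c') := fun h => by
      obtain ⟨c', hc', e⟩ := Finset.mem_image.1 h
      by_cases hcc : c' = c
      · rw [hcc] at e
        exact hi' (Prod.ext_iff.1 ((cellEmb m c).injective e)).1.symm
      · refine hι c' hc' c hc (fun h => hcc h.symm) ?_
        rw [e]
        exact Finset.mem_map.2 ⟨(i, i), Finset.mem_univ _, rfl⟩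
    rw [freeFun, if_neg hnot, if_pos (Finset.mem_biUnion.2 ⟨c, hc, mem_diagCells.2 ⟨i, rfl⟩⟩)]

/-- **(T2)** the diagonal of a block `b ∉ S` is killed (`2·|S| < m`): it cannot lie inside the
free blocks' cells, two blocks sharing `≤ 2` cells. -/
theorem prod_freeFun_of_not_mem (hm : 3 ≤ m) (S : Finset (Fin 3 → Fin (qOf m)))
    (ι : (Fin 3 → Fin (qOf m)) → Fin m) (i₀ : Fin m) (t : ℂ) {b : Fin 3 → Fin (qOf m)}
    (hb : b ∉ S) (hS : 2 * S.card < m) :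
    ∏ i, freeFun m S ι i₀ t (cellEmb m b (i, i)) = 0 := by
  classical
  obtain ⟨i, hi⟩ : ∃ i, cellEmb m b (i, i) ∉ S.biUnion (diagCells m) := by
    by_contra! hall
    have hsub : (Finset.univ.image fun i : Fin m => cellEmb m b (i, i)) ⊆
        S.biUnion fun c => cells m c ∩ cells m b := by
      intro x hx
      obtain ⟨i, -, rfl⟩ := Finset.mem_image.1 hx
      obtain ⟨c, hc, hcx⟩ := Finset.mem_biUnion.1 (hall i)
      exact Finset.mem_biUnion.2 ⟨c, hc, Finset.mem_inter.2
        ⟨diagCells_subset_cells c hcx, Finset.mem_map.2 ⟨(i, i), Finset.mem_univ _, rfl⟩⟩⟩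
    have hcard : (Finset.univ.image fun i : Fin m => cellEmb m b (i, i)).card = m := by
      rw [Finset.card_image_of_injective _ fun i j hij =>
        (Prod.ext_iff.1 ((cellEmb m b).injective hij)).1, Finset.card_univ, Fintype.card_fin]
    have h2 : (S.biUnion fun c => cells m c ∩ cells m b).card ≤ S.card * 2 :=
      Finset.card_biUnion_le_card_mul _ _ _ fun c hc =>
        card_cells_inter_le fun e => hb (e ▸ hc)
    have h3 := Finset.card_le_card hsub
    omega
  have h1 : cellEmb m b (i, i) ∉ S.image fun c => cellEmb m c (ι c, ι c) := fun h => by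
    obtain ⟨c, hc, e⟩ := Finset.mem_image.1 h
    exact hi (Finset.mem_biUnion.2 ⟨c, hc, mem_diagCells.2 ⟨ι c, e⟩⟩)
  have hcol : ∀ j, (cellEmb m b (i, i)).1 ≠ rotCol m j := fun j e => by
    have h := Prod.ext_iff.1 ((permPad (sq_le_qOf m)).injective
      ((cellEmb_fst m b (i, i)).symm.trans e))
    exact absurd (h.1.symm.trans h.2) (Equiv.Perm.mem_support.1
      (by rw [support_finRotate_of_le (by omega : 2 ≤ m)]; exact Finset.mem_univ j))
  have hmem : (cellEmb m b (i, i)).1 ∉ Finset.univ.image (rotCol m) := fun hmem => by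
    obtain ⟨j, -, hj⟩ := Finset.mem_image.1 hmem
    exact hcol j hj.symm
  exact Finset.prod_eq_zero (Finset.mem_univ i)
    (by rw [freeFun, if_neg h1, if_neg hi, if_neg (hcol i₀), if_neg hmem])

/-- **(T1)** `Θ(P_c) = X_c` for a free block. -/
theorem freeHom_kiPer_of_mem (hm : 3 ≤ m) (S : Finset (Fin 3 → Fin (qOf m)))
    (ι : (Fin 3 → Fin (qOf m)) → Fin m) (i₀ : Fin m) (t : ℂ)
    (hι : ∀ c ∈ S, ∀ c' ∈ S, c' ≠ c → cellEmb m c (ι c, ι c) ∉ cells m c')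
    {c : Fin 3 → Fin (qOf m)} (hc : c ∈ S) : freeHom m S ι i₀ t (kiPer m c) = X c := by
  rw [freeHom_kiPer hm, prod_freeFun_of_mem S ι i₀ t hι hc, sub_add_cancel]

/-- **(T2)** `Θ(P_b) = t` for a non-free block. -/
theorem freeHom_kiPer_of_not_mem (hm : 3 ≤ m) (S : Finset (Fin 3 → Fin (qOf m)))
    (ι : (Fin 3 → Fin (qOf m)) → Fin m) (i₀ : Fin m) (t : ℂ) {b : Fin 3 → Fin (qOf m)}
    (hb : b ∉ S) (hS : 2 * S.card < m) : freeHom m S ι i₀ t (kiPer m b) = C t := by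
  rw [freeHom_kiPer hm, prod_freeFun_of_not_mem hm S ι i₀ t hb hS, zero_add]

/-- Private diagonal cells exist when `2·|S| < m`. -/
theorem exists_private (S : Finset (Fin 3 → Fin (qOf m))) (hS : 2 * S.card < m) :
    ∃ ι : (Fin 3 → Fin (qOf m)) → Fin m,
      ∀ c ∈ S, ∀ c' ∈ S, c' ≠ c → cellEmb m c (ι c, ι c) ∉ cells m c' := by
  classical
  have key : ∀ c ∈ S, ∃ i : Fin m, ∀ c' ∈ S, c' ≠ c → cellEmb m c (i, i) ∉ cells m c' := by
    intro c hc
    by_contra! hall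
    have hsub : (Finset.univ.image fun i : Fin m => cellEmb m c (i, i)) ⊆
        (S.erase c).biUnion fun c' => cells m c' ∩ cells m c := by
      intro x hx
      obtain ⟨i, -, rfl⟩ := Finset.mem_image.1 hx
      obtain ⟨c', hc', hne, hmem⟩ := hall i
      exact Finset.mem_biUnion.2 ⟨c', Finset.mem_erase.2 ⟨hne, hc'⟩, Finset.mem_inter.2
        ⟨hmem, Finset.mem_map.2 ⟨(i, i), Finset.mem_univ _, rfl⟩⟩⟩
    have hcard : (Finset.univ.image fun i : Fin m => cellEmb m c (i, i)).card = m := by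
      rw [Finset.card_image_of_injective _ fun i j hij =>
        (Prod.ext_iff.1 ((cellEmb m c).injective hij)).1, Finset.card_univ, Fintype.card_fin]
    have h2 : ((S.erase c).biUnion fun c' => cells m c' ∩ cells m c).card ≤ (S.erase c).card * 2 :=
      Finset.card_biUnion_le_card_mul _ _ _ fun c' hc' =>
        card_cells_inter_le (Finset.ne_of_mem_erase hc')
    have h3 := Finset.card_le_card hsub
    rw [Finset.card_erase_of_mem hc] at h2
    omega
  choose ι hι using key
  refine ⟨fun c => if h : c ∈ S then ι c h else ⟨0, by omega⟩, fun c hc c' hc' hne => ?_⟩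
  simp only [dif_pos hc]
  exact hι c hc c' hc' hne

/-- **(T3)** `Θ(φ E)` is the restriction of `E` to the free variables `S` (the others at `t`). -/
theorem freeHom_bind₁ (hm : 3 ≤ m) {S : Finset (Fin 3 → Fin (qOf m))} (hS : 2 * S.card < m)
    {ι : (Fin 3 → Fin (qOf m)) → Fin m}
    (hι : ∀ c ∈ S, ∀ c' ∈ S, c' ≠ c → cellEmb m c (ι c, ι c) ∉ cells m c') (i₀ : Fin m) (t : ℂ)
    (E : MvPolynomial (Fin 3 → Fin (qOf m)) ℂ) :
    freeHom m S ι i₀ t (bind₁ (kiPer m) E) =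
      aeval (fun b => if b ∈ S then X b else (C t : MvPolynomial (Fin 3 → Fin (qOf m)) ℂ)) E := by
  rw [← AlgHom.comp_apply, ← aeval_eq_bind₁, comp_aeval]
  refine DFunLike.congr_fun (congrArg (fun f => aeval f) (funext fun b => ?_)) E
  show freeHom m S ι i₀ t (kiPer m b) = (if b ∈ S then X b else C t)
  by_cases hb : b ∈ S
  · rw [if_pos hb]
    exact freeHom_kiPer_of_mem hm S ι i₀ t hι hb
  · rw [if_neg hb]
    exact freeHom_kiPer_of_not_mem hm S ι i₀ t hb hS

/-- Consequence: `φ E = 0` kills every restriction of `E` to fewer than `m/2` free variables. -/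
theorem aeval_restrict_eq_zero (hm : 3 ≤ m) (S : Finset (Fin 3 → Fin (qOf m)))
    (hS : 2 * S.card < m) (t : ℂ) {E : MvPolynomial (Fin 3 → Fin (qOf m)) ℂ}
    (hE : bind₁ (kiPer m) E = 0) :
    aeval (fun b => if b ∈ S then X b else (C t : MvPolynomial (Fin 3 → Fin (qOf m)) ℂ)) E = 0 := by
  obtain ⟨ι, hι⟩ := exists_private S hS
  rw [← freeHom_bind₁ hm hS hι ⟨0, by omega⟩ t E, hE, map_zero]

/-! ## 2. `G_m` hits every nonsingular read-once chain of width `w ≤ (m+1)/2` -/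

/-- ★ For `3 ≤ m`, `2w ≤ m + 1`, an injective read order and univariate links that are
nonsingular as polynomial matrices, a nonzero chain polynomial stays nonzero under `φ`.
[nonsingular constant width · 0 S-currency · closes no item · singular links / w = q^b NOT claimed] -/
theorem kiPer_hits_chainPoly (hm : 3 ≤ m) {w N : ℕ} (hw : 2 * w ≤ m + 1)
    (π : Fin N → (Fin 3 → Fin (qOf m))) (hπ : Function.Injective π)
    (P : Fin N → Matrix (Fin w) (Fin w) ℂ[X]) (hP : ∀ i, (P i).det ≠ 0) (u v : Fin w → ℂ)
    (hD : chainPoly π P u v ≠ 0) : bind₁ (kiPer m) (chainPoly π P u v) ≠ 0 := by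
  classical
  intro h
  obtain ⟨t, ht⟩ : ∃ t : ℂ, ∀ i, ((P i).map (Polynomial.eval t)).det ≠ 0 := by
    obtain ⟨t, ht⟩ := Infinite.exists_notMem_finset
      (Finset.univ.biUnion fun i : Fin N => (P i).det.roots.toFinset)
    refine ⟨t, fun i hzero => ht (Finset.mem_biUnion.2 ⟨i, Finset.mem_univ _,
      Multiset.mem_toFinset.2 ((Polynomial.mem_roots (hP i)).2 ?_)⟩)⟩
    have hev : ((P i).map (Polynomial.eval t)).det = (P i).det.eval t := by
      rw [← Polynomial.coe_evalRingHom, RingHom.map_det, RingHom.mapMatrix_apply]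
    rw [Polynomial.IsRoot.def, ← hev]
    exact hzero
  exact hD (chainPoly_eq_zero_of_restrict π hπ P u v t ht fun S hS =>
    aeval_restrict_eq_zero hm S (by omega) t h)

/-- ★ in matrix-product currency (`Literature…FSV18SuccinctGenerators.IsROABP` unfolds to such a
product): layers `M_i` univariate in `z_{π i}` (`π` injective) with `det M_i ≠ 0`, width
`w ≤ (m+1)/2`, `m ≥ 3` — any nonzero entry of `M_1 ⋯ M_N` stays nonzero under `φ`. -/
theorem kiPer_hits_matrixProduct_of_det_ne_zero (hm : 3 ≤ m) {w N : ℕ} (hw : 2 * w ≤ m + 1)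
    (π : Fin N → (Fin 3 → Fin (qOf m))) (hπ : Function.Injective π)
    (M : Fin N → Matrix (Fin w) (Fin w) (MvPolynomial (Fin 3 → Fin (qOf m)) ℂ))
    (hM : ∀ i a b, ∃ p : ℂ[X],
      M i a b = Polynomial.aeval (X (π i) : MvPolynomial (Fin 3 → Fin (qOf m)) ℂ) p)
    (hdet : ∀ i, (M i).det ≠ 0) (a b : Fin w) (hD : (List.ofFn M).prod a b ≠ 0) :
    bind₁ (kiPer m) ((List.ofFn M).prod a b) ≠ 0 := by
  classical
  choose p hp using hM
  have hMP : ∀ i, M i = (Matrix.of (p i)).map (Polynomial.aeval (X (π i))) := fun i =>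
    Matrix.ext fun a b => by rw [Matrix.map_apply, Matrix.of_apply]; exact hp i a b
  have hP : ∀ i, (Matrix.of (p i)).det ≠ 0 := fun i h0 =>
    hdet i (by rw [hMP i, ← AlgHom.mapMatrix_apply, ← AlgHom.map_det, h0, map_zero])
  have hL : (List.ofFn fun i => (Matrix.of (p i)).map (Polynomial.aeval (X (π i)))) = List.ofFn M :=
    congrArg List.ofFn (funext fun i => (hMP i).symm)
  have hval : (List.ofFn M).prod a b =
      chainPoly π (fun i => Matrix.of (p i)) (Pi.single a 1) (Pi.single b 1) := by
    rw [chainPoly, hL, dotProduct, Fintype.sum_eq_single a fun j hj => by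
      rw [Pi.single_eq_of_ne hj, C_0, zero_mul], Pi.single_eq_same, C_1, one_mul]
    simp only [Matrix.mulVec, dotProduct]
    rw [Fintype.sum_eq_single b fun j hj => by rw [Pi.single_eq_of_ne hj, C_0, mul_zero],
      Pi.single_eq_same, C_1, mul_one]
  rw [hval] at hD ⊢
  exact kiPer_hits_chainPoly hm hw π hπ _ hP _ _ hD

end Summit.ValiantsHypothesis.ValiantsHypothesis.Theorems.DefinabilityGapFreeAxes

end
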